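import Mathlib
import HarnessLib
import Literature.MathematicalPhysics.StatisticalMechanics.TorusFiniteRangeDecomposition

/-!
# Relevant Hamiltonians of the gradient renormalisation group (Adams–Buchholz–Kotecký–Müller,
# Ch. 6.2): the space `M_0(𝓑_k)` spanned by `1`, `∇^α φ(x)` (`1 ≤ |α| ≤ ⌊d/2⌋+1`),
# `∇_i φ(x) ∇_j φ(x)`, summed over a block

In the multiscale analysis of gradient models on the torus `(ℤ/L^N)^d` (Adams–Kotecký–Müller,
Adams–Buchholz–Kotecký–Müller) the renormalisation map `T_k : (H_k, K_k) ↦ (H_{k+1}, K_{k+1})` carries,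
next to the irrelevant polymer activity `K_k`, a RELEVANT HAMILTONIAN `H_k ∈ M_0(𝓑_k)`:
a functional of the form `H(B, φ) = Σ_{x ∈ B} 𝓗({x}, φ)` where `𝓗({x}, ·)` is a linear combination of
the RELEVANT MONOMIALS
* the constant monomial `1`;
* the linear monomials `∇^α φ(x)` with `1 ≤ |α| ≤ ⌊d/2⌋ + 1` (`∇^α = Π_i ∇_i^{α_i}`, forward
  differences);
* the quadratic monomials `∇_i φ(x) ∇_j φ(x)` (`|α| = |β| = 1`)
(source, display after "Finally, we introduce the space of relevant Hamiltonians
`M_0(𝓑_k) ⊂ M(𝓑_k)`", Ch. 6.2; the scaling heuristic singling out exactly these monomials follows it).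
One component (`m = 1`).  The coefficients are taken in a commutative ring `𝕜` with an
`ℝ`-algebra structure (`ℝ` in the source; `ℂ` for complex perturbations, where the reflection
`φ ↦ −φ` composed with complex conjugation singles out the subspace of Hamiltonians with real
constant and quadratic and imaginary linear coefficients).

## Contents (definitions and their elementary algebra; everything stated is proved)
* `linIndex d` — the multi-indices `α : Fin d → ℕ` with `1 ≤ |α| ≤ ⌊d/2⌋ + 1`; `quadIndex d` — the
  pairs `i ≤ j`; `RelIndex d = Unit ⊕ linIndex d ⊕ quadIndex d` — the index set of the relevant
  monomials (for `d = 4`: `1 + 34 + 10 = 45` of them, `card_relIndex_four`);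
* `GradientRG.RelevantHamiltonian 𝕜 d := RelIndex d → 𝕜` — the coefficient space `M_0` (a free `𝕜`-module;
  it inherits the `Pi` module and norm structures);
* `relMonomial ι φ x` — the monomials as functions of the field; `density H φ x = 𝓗({x}, φ)`;
  `eval H B φ = H(B, φ) = Σ_{x∈B} 𝓗({x}, φ)`;
* linearity in `H` (`density_add/smul/zero`, `eval_add/smul/zero`), additivity in the block
  (`eval_union`), and the value at the zero field (`density_zero_field`: only the constant survives).

What is NOT here: the norm `‖H‖_{k,0}` (it is the `T_0`-seminorm of `H(B)` and belongs with the
norms of §6.4), the projection `Π_2` onto `M_0` (§8.4), locality as members of `M(𝓑_k)`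
(§6.2), `m > 1` components.  (Shift invariance `H(B, φ + c) = H(B, φ)` IS here: `eval_add_const`.)
-- TODO(general form): `m ≥ 1` components `∇^α φ_i`, `∇^α φ_i ∇^β φ_j`, as in the source.

## References
* S. Adams, S. Buchholz, R. Kotecký, S. Müller, *Cauchy–Born rule from microscopic models with
  non-convex potentials*, arXiv:1910.13564, Ch. 6.2 (relevant Hamiltonians `M_0(𝓑_k)`, the three
  families of relevant monomials) [AdamsBuchholzKoteckyMuller2019].
* S. Adams, R. Kotecký, S. Müller, arXiv:1606.09541, Ch. 4 (ideal Hamiltonians; same space)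
  [AdamsKoteckyMuller2016].
-/

noncomputable section

namespace Literature.MathematicalPhysics.StatisticalMechanics.GradientRG

open scoped BigOperators
open Literature.MathematicalPhysics.StatisticalMechanics.GradientFRD (fwdDiff iterDiff)

/-! ## The index set of the relevant monomials -/

/-- The multi-indices of the LINEAR relevant monomials `∇^α φ(x)`: `α : Fin d → ℕ` with
`1 ≤ |α|₁ ≤ ⌊d/2⌋ + 1` (each component is then `< ⌊d/2⌋ + 2`).
[cite: AdamsBuchholzKoteckyMuller2019, Ch. 6.2 (relevant monomials, linear)] -/
def linIndex (d : ℕ) : Finset (Fin d → ℕ) :=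
  (Fintype.piFinset fun _ : Fin d => Finset.range (d / 2 + 2)).filter
    fun α => 1 ≤ ∑ i, α i ∧ ∑ i, α i ≤ d / 2 + 1

/-- Membership in `linIndex`: exactly the condition `1 ≤ |α|₁ ≤ ⌊d/2⌋ + 1`.
[cite: AdamsBuchholzKoteckyMuller2019, Ch. 6.2 (relevant monomials, linear)] -/
theorem mem_linIndex {d : ℕ} {α : Fin d → ℕ} :
    α ∈ linIndex d ↔ 1 ≤ ∑ i, α i ∧ ∑ i, α i ≤ d / 2 + 1 := by
  rw [linIndex, Finset.mem_filter, Fintype.mem_piFinset]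
  constructor
  · exact fun h => h.2
  · intro h
    refine ⟨fun i => Finset.mem_range.2 ?_, h⟩
    have hi : α i ≤ ∑ j, α j :=
      Finset.single_le_sum (f := α) (fun j _ => Nat.zero_le _) (Finset.mem_univ i)
    omega

/-- The index pairs `i ≤ j` of the QUADRATIC relevant monomials `∇_i φ(x) ∇_j φ(x)` (the source
indexes the symmetric coefficients `a_{(i,α),(j,β)}`, `|α| = |β| = 1`, by ordered pairs
`(i,α) ≤ (j,β)`). [cite: AdamsBuchholzKoteckyMuller2019, Ch. 6.2 (relevant monomials, quadratic)] -/
abbrev quadIndex (d : ℕ) : Type := {p : Fin d × Fin d // p.1 ≤ p.2}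

/-- The index set of ALL relevant monomials: the constant, the linear ones, the quadratic ones.
[cite: AdamsBuchholzKoteckyMuller2019, Ch. 6.2 (relevant monomials)] -/
abbrev RelIndex (d : ℕ) : Type := Unit ⊕ (linIndex d) ⊕ quadIndex d

/-- In `d = 4` (one component) there are `45` relevant monomials: `1` constant, `34` linear
(`|α| = 1, 2, 3`: `4 + 10 + 20`), `10` quadratic. [cite: AdamsBuchholzKoteckyMuller2019, Ch. 6.2 (relevant monomials)] -/
theorem card_relIndex_four : Fintype.card (RelIndex 4) = 45 := by
  have h1 : (linIndex 4).card = 34 := by decide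
  have h2 : Fintype.card (quadIndex 4) = 10 := by decide
  rw [Fintype.card_sum, Fintype.card_sum, Fintype.card_unit, Fintype.card_coe, h1, h2]

/-! ## The coefficient space `M_0` and the evaluation `H(B, φ)` -/

/-- **The space of relevant Hamiltonians** `M_0` (one component, dimension `d`, coefficients in
`𝕜`): coefficient vectors indexed by the relevant monomials.  As a `Pi` type it is a free
`𝕜`-module of rank `|RelIndex d|` and carries the product topology/norms; the scale-dependent norm
`‖H‖_{k,0}` of the source is NOT this sup norm (it is defined with the norms of §6.4).
[cite: AdamsBuchholzKoteckyMuller2019, Ch. 6.2 (the space M_0(𝓑_k))] -/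
abbrev RelevantHamiltonian (𝕜 : Type*) (d : ℕ) : Type _ := RelIndex d → 𝕜

variable {𝕜 : Type*} [CommRing 𝕜] [Algebra ℝ 𝕜] {d M : ℕ}

/-- The relevant monomials as real functions of the field at a site: `1`, `∇^α φ(x)`,
`∇_i φ(x) ∇_j φ(x)`. [cite: AdamsBuchholzKoteckyMuller2019, Ch. 6.2 (relevant monomials)] -/
def relMonomial (ι : RelIndex d) (φ : (Fin d → ZMod M) → ℝ) (x : Fin d → ZMod M) : ℝ :=
  match ι with
  | Sum.inl _ => 1
  | Sum.inr (Sum.inl α) => iterDiff α.1 φ x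
  | Sum.inr (Sum.inr p) => fwdDiff p.1.1 φ x * fwdDiff p.1.2 φ x

/-- The constant monomial is `1`. [cite: AdamsBuchholzKoteckyMuller2019, Ch. 6.2 (relevant monomials)] -/
@[simp] theorem relMonomial_const (u : Unit) (φ : (Fin d → ZMod M) → ℝ) (x : Fin d → ZMod M) :
    relMonomial (Sum.inl u) φ x = 1 := rfl

/-- The linear monomials are `∇^α φ(x)`. [cite: AdamsBuchholzKoteckyMuller2019, Ch. 6.2 (relevant monomials)] -/
@[simp] theorem relMonomial_lin (α : linIndex d) (φ : (Fin d → ZMod M) → ℝ) (x : Fin d → ZMod M) :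
    relMonomial (Sum.inr (Sum.inl α)) φ x = iterDiff α.1 φ x := rfl

/-- The quadratic monomials are `∇_i φ(x) ∇_j φ(x)`. [cite: AdamsBuchholzKoteckyMuller2019, Ch. 6.2 (relevant monomials)] -/
@[simp] theorem relMonomial_quad (p : quadIndex d) (φ : (Fin d → ZMod M) → ℝ)
    (x : Fin d → ZMod M) :
    relMonomial (Sum.inr (Sum.inr p)) φ x = fwdDiff p.1.1 φ x * fwdDiff p.1.2 φ x := rfl

/-- The DENSITY `𝓗({x}, φ) = Σ_ι H_ι · (relevant monomial ι at x)` of a relevant Hamiltonian.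
[cite: AdamsBuchholzKoteckyMuller2019, Ch. 6.2 (H(B,φ) = Σ_{x∈B} 𝓗({x},φ))] -/
def density (H : RelevantHamiltonian 𝕜 d) (φ : (Fin d → ZMod M) → ℝ) (x : Fin d → ZMod M) : 𝕜 :=
  ∑ ι : RelIndex d, (relMonomial ι φ x) • H ι

/-- **`H(B, φ) = Σ_{x ∈ B} 𝓗({x}, φ)`** — the relevant Hamiltonian as a functional of the field on a
block (or any finite set of sites) `B`. [cite: AdamsBuchholzKoteckyMuller2019, Ch. 6.2 (H(B,φ) = Σ_{x∈B} 𝓗({x},φ))] -/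
def eval (H : RelevantHamiltonian 𝕜 d) (B : Finset (Fin d → ZMod M)) (φ : (Fin d → ZMod M) → ℝ) :
    𝕜 :=
  ∑ x ∈ B, density H φ x

/-! ## Elementary algebra -/

/-- The density is additive in `H`. [cite: AdamsBuchholzKoteckyMuller2019, Ch. 6.2 (M_0 is a linear space)] -/
theorem density_add (H H' : RelevantHamiltonian 𝕜 d) (φ : (Fin d → ZMod M) → ℝ)
    (x : Fin d → ZMod M) : density (H + H') φ x = density H φ x + density H' φ x := by
  simp only [density, Pi.add_apply, smul_add, Finset.sum_add_distrib]

/-- The density is `𝕜`-homogeneous in `H`. [cite: AdamsBuchholzKoteckyMuller2019, Ch. 6.2 (M_0 is a linear space)] -/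
theorem density_smul (c : 𝕜) (H : RelevantHamiltonian 𝕜 d) (φ : (Fin d → ZMod M) → ℝ)
    (x : Fin d → ZMod M) : density (c • H) φ x = c * density H φ x := by
  simp only [density, Pi.smul_apply, smul_eq_mul, Finset.mul_sum, mul_smul_comm]

/-- The zero Hamiltonian has zero density. [cite: AdamsBuchholzKoteckyMuller2019, Ch. 6.2 (M_0 is a linear space)] -/
@[simp] theorem density_zero (φ : (Fin d → ZMod M) → ℝ) (x : Fin d → ZMod M) :
    density (0 : RelevantHamiltonian 𝕜 d) φ x = 0 := by
  simp [density]

/-- `H ↦ H(B, φ)` is additive. [cite: AdamsBuchholzKoteckyMuller2019, Ch. 6.2 (M_0 is a linear space)] -/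
theorem eval_add (H H' : RelevantHamiltonian 𝕜 d) (B : Finset (Fin d → ZMod M))
    (φ : (Fin d → ZMod M) → ℝ) : eval (H + H') B φ = eval H B φ + eval H' B φ := by
  simp only [eval, density_add, Finset.sum_add_distrib]

/-- `H ↦ H(B, φ)` is `𝕜`-homogeneous. [cite: AdamsBuchholzKoteckyMuller2019, Ch. 6.2 (M_0 is a linear space)] -/
theorem eval_smul (c : 𝕜) (H : RelevantHamiltonian 𝕜 d) (B : Finset (Fin d → ZMod M))
    (φ : (Fin d → ZMod M) → ℝ) : eval (c • H) B φ = c * eval H B φ := by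
  simp only [eval, density_smul, Finset.mul_sum]

/-- `0(B, φ) = 0`. [cite: AdamsBuchholzKoteckyMuller2019, Ch. 6.2 (M_0 is a linear space)] -/
@[simp] theorem eval_zero (B : Finset (Fin d → ZMod M)) (φ : (Fin d → ZMod M) → ℝ) :
    eval (0 : RelevantHamiltonian 𝕜 d) B φ = 0 := by
  simp [eval]

/-- **Additivity over the block**: `H(B ∪ B', φ) = H(B, φ) + H(B', φ)` for disjoint `B, B'` — the
structure `H(X) = Σ_{B ∈ 𝓑_k(X)} H(B)` of functionals on blocks extended to polymers.
[cite: AdamsBuchholzKoteckyMuller2019, Ch. 6.2 (F(X,φ) = Σ_{B∈𝓑_k(X)} F(B,φ) for F ∈ M(𝓑_k))] -/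
theorem eval_union (H : RelevantHamiltonian 𝕜 d) {B B' : Finset (Fin d → ZMod M)}
    (h : Disjoint B B') (φ : (Fin d → ZMod M) → ℝ) :
    eval H (B ∪ B') φ = eval H B φ + eval H B' φ := by
  rw [eval, Finset.sum_union h, eval, eval]

/-- `H(∅, φ) = 0`. [cite: AdamsBuchholzKoteckyMuller2019, Ch. 6.2 (H(B,φ) = Σ_{x∈B} 𝓗({x},φ))] -/
@[simp] theorem eval_empty (H : RelevantHamiltonian 𝕜 d) (φ : (Fin d → ZMod M) → ℝ) :
    eval H ∅ φ = 0 := by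
  simp [eval]

/-- Forward differences of the zero field vanish. [folklore] -/
private theorem fwdDiff_zero_field (i : Fin d) : fwdDiff i (0 : (Fin d → ZMod M) → ℝ) = 0 := by
  funext x; exact sub_self _

/-- Iterated forward differences of the zero field vanish. [folklore] -/
private theorem iterDiff_zero_field (α : Fin d → ℕ) :
    iterDiff α (0 : (Fin d → ZMod M) → ℝ) = 0 := by
  unfold iterDiff
  induction (List.finRange d) with
  | nil => rfl
  | cons i l ih =>
      rw [List.foldr_cons, ih]
      induction α i with
      | zero => rfl
      | succ k ihk => rw [Function.iterate_succ_apply', ihk, fwdDiff_zero_field]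

/-- **At the zero field only the constant monomial survives**: `𝓗({x}, 0) = H_∅` (the source's
extraction of the energy). [cite: AdamsBuchholzKoteckyMuller2019, Ch. 6.2 (relevant monomials)] -/
theorem density_zero_field (H : RelevantHamiltonian 𝕜 d) (x : Fin d → ZMod M) :
    density H (0 : (Fin d → ZMod M) → ℝ) x = H (Sum.inl ()) := by
  rw [density, Fintype.sum_sum_type, Fintype.sum_sum_type]
  simp only [Finset.univ_unique, PUnit.default_eq_unit, Finset.sum_singleton, relMonomial_const,
    one_smul, relMonomial_lin, iterDiff_zero_field, Pi.zero_apply, zero_smul,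
    Finset.sum_const_zero, relMonomial_quad, fwdDiff_zero_field, mul_zero, add_zero]

/-! ## Shift invariance (appended): `H(B, φ + c) = H(B, φ)`

"Any `H ∈ M_0(𝓑_k)` is clearly shift invariant" (source, end of Ch. 6.2): every relevant monomial
except the constant carries at least one forward difference, and `∇_i` kills constants. -/

/-- `∇_i` is additive. [cite: AdamsBuchholzKoteckyMuller2019, Ch. 6.2 (discrete derivatives, shift invariance of M_0)] -/
theorem fwdDiff_add (i : Fin d) (f g : (Fin d → ZMod M) → ℝ) :
    fwdDiff i (f + g) = fwdDiff i f + fwdDiff i g := by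
  funext x
  simp only [Literature.MathematicalPhysics.StatisticalMechanics.GradientFRD.fwdDiff, Pi.add_apply]
  ring

/-- `∇_i` kills constants. [cite: AdamsBuchholzKoteckyMuller2019, Ch. 6.2 (discrete derivatives, shift invariance of M_0)] -/
theorem fwdDiff_const (i : Fin d) (c : ℝ) : fwdDiff i (fun _ : Fin d → ZMod M => c) = 0 := by
  funext x; exact sub_self _

/-- `∇_i 0 = 0`. [cite: AdamsBuchholzKoteckyMuller2019, Ch. 6.2 (discrete derivatives, shift invariance of M_0)] -/
theorem fwdDiff_zero (i : Fin d) : fwdDiff i (0 : (Fin d → ZMod M) → ℝ) = 0 :=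
  fwdDiff_const i 0

/-- Iterates of `∇_i` are additive. [cite: AdamsBuchholzKoteckyMuller2019, Ch. 6.2 (discrete derivatives, shift invariance of M_0)] -/
theorem iterate_fwdDiff_add (i : Fin d) (k : ℕ) (f g : (Fin d → ZMod M) → ℝ) :
    (fwdDiff i)^[k] (f + g) = (fwdDiff i)^[k] f + (fwdDiff i)^[k] g := by
  induction k generalizing f g with
  | zero => rfl
  | succ k ih => rw [Function.iterate_succ_apply, Function.iterate_succ_apply,
      Function.iterate_succ_apply, fwdDiff_add, ih]

/-- Iterates of `∇_i` vanish on `0`. [cite: AdamsBuchholzKoteckyMuller2019, Ch. 6.2 (discrete derivatives, shift invariance of M_0)] -/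
theorem iterate_fwdDiff_zero (i : Fin d) (k : ℕ) : (fwdDiff i)^[k] (0 : (Fin d → ZMod M) → ℝ) = 0 := by
  induction k with
  | zero => rfl
  | succ k ih => rw [Function.iterate_succ_apply, fwdDiff_zero, ih]

/-- `∇^α` is additive. [cite: AdamsBuchholzKoteckyMuller2019, Ch. 6.2 (discrete derivatives, shift invariance of M_0)] -/
theorem iterDiff_add (α : Fin d → ℕ) (f g : (Fin d → ZMod M) → ℝ) :
    iterDiff α (f + g) = iterDiff α f + iterDiff α g := by
  unfold iterDiff
  induction (List.finRange d) with
  | nil => rfl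
  | cons i l ih => rw [List.foldr_cons, List.foldr_cons, List.foldr_cons, ih, iterate_fwdDiff_add]

/-- `∇^α c = 0` for a constant field `c` as soon as `|α| ≥ 1`. [cite: AdamsBuchholzKoteckyMuller2019, Ch. 6.2 (discrete derivatives, shift invariance of M_0)] -/
theorem iterDiff_const_eq_zero {α : Fin d → ℕ} (hα : 1 ≤ ∑ i, α i) (c : ℝ) :
    iterDiff α (fun _ : Fin d → ZMod M => c) = 0 := by
  -- invariant along the fold: the result is the constant if all processed orders vanish, else `0`
  have key : ∀ l : List (Fin d),
      l.foldr (fun i g => (fwdDiff i)^[α i] g) (fun _ : Fin d → ZMod M => c) =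
        if ∀ i ∈ l, α i = 0 then (fun _ => c) else (0 : (Fin d → ZMod M) → ℝ) := by
    intro l
    induction l with
    | nil => simp
    | cons i l ih =>
        rw [List.foldr_cons, ih]
        by_cases hi : α i = 0
        · rw [hi, Function.iterate_zero, id]
          by_cases hl : ∀ j ∈ l, α j = 0
          · rw [if_pos hl, if_pos (by simpa [hi] using hl)]
          · rw [if_neg hl, if_neg (by simp [hi, hl])]
        · obtain ⟨k, hk⟩ := Nat.exists_eq_succ_of_ne_zero hi
          have hne : ¬ ∀ j ∈ i :: l, α j = 0 := fun h => hi (h i (by simp))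
          rw [if_neg hne, hk]
          split_ifs
          · rw [Function.iterate_succ_apply, fwdDiff_const, iterate_fwdDiff_zero]
          · exact iterate_fwdDiff_zero i (k + 1)
  unfold iterDiff
  rw [key]
  have hex : ¬ ∀ i ∈ List.finRange d, α i = 0 := by
    intro h
    have : ∑ i, α i = 0 := Finset.sum_eq_zero fun i _ => h i (List.mem_finRange i)
    omega
  rw [if_neg hex]

/-- Every relevant monomial is invariant under constant shifts of the field (the constant monomial
trivially, the others because `|α| ≥ 1`). [cite: AdamsBuchholzKoteckyMuller2019, Ch. 6.2 (H ∈ M_0 is shift invariant)] -/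
theorem relMonomial_add_const (ι : RelIndex d) (φ : (Fin d → ZMod M) → ℝ) (c : ℝ)
    (x : Fin d → ZMod M) : relMonomial ι (φ + fun _ => c) x = relMonomial ι φ x := by
  rcases ι with u | α | p
  · rfl
  · have hα := (mem_linIndex.1 α.2).1
    simp only [relMonomial_lin, iterDiff_add, iterDiff_const_eq_zero hα, Pi.add_apply,
      Pi.zero_apply, add_zero]
  · simp only [relMonomial_quad, fwdDiff_add, fwdDiff_const, Pi.add_apply, Pi.zero_apply, add_zero]

/-- **Shift invariance of the density**: `𝓗({x}, φ + c) = 𝓗({x}, φ)`.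
[cite: AdamsBuchholzKoteckyMuller2019, Ch. 6.2 (H ∈ M_0 is shift invariant)] -/
theorem density_add_const (H : RelevantHamiltonian 𝕜 d) (φ : (Fin d → ZMod M) → ℝ) (c : ℝ)
    (x : Fin d → ZMod M) : density H (φ + fun _ => c) x = density H φ x := by
  simp only [density, relMonomial_add_const]

/-- **Shift invariance of relevant Hamiltonians**: `H(B, φ + c) = H(B, φ)` for every constant field
`c` — the membership `M_0(𝓑_k) ⊂ M(𝓑_k)` (functionals of the gradient field).
[cite: AdamsBuchholzKoteckyMuller2019, Ch. 6.2 (H ∈ M_0 is shift invariant)] -/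
theorem eval_add_const (H : RelevantHamiltonian 𝕜 d) (B : Finset (Fin d → ZMod M))
    (φ : (Fin d → ZMod M) → ℝ) (c : ℝ) : eval H B (φ + fun _ => c) = eval H B φ := by
  simp only [eval, density_add_const]

end Literature.MathematicalPhysics.StatisticalMechanics.GradientRG

end
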